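import Literature.NumberTheory.Automorphic.RegularOrbitChartProductNonarch   -- ★ chart-2 (and ★ chart-A through it)
import Literature.LinearAlgebra.Matrix.UnitaryFormAdjointCayley             -- ★ FILE 1: `cayley`, `θ_J`, `U(σ, J)`
import HarnessLib

/-!
# The regular orbit chart in Cayley coordinates, and its restriction to a unitary group `U(σ, J)`

Topic `NumberTheory/Automorphic`; namespace `Literature.NumberTheory.Automorphic`. KERNEL mathematics only: theorems,
no definition, no named fact, no instance, no notation, no `sorry`.  Written for the cell `pub/hodgecm-mathlib` (LEAD
F0P3a-plan (g9) WORD T8-2 (2), brick «N6ns-chart-3», FILE 2 of 2; consumer F0P3a-p03 (g9) «N6ns-reg-(ii)»: regular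
orbital integrals of `U(3)` are locally constant in chart coordinates at non-split places).

SETTING. `E` a complete nontrivially normed field of characteristic `0` (so `2` is a unit and `E` is perfect),
`M = M_n(E)` with Mathlib's scoped `L^∞`-operator norm (`Matrix.Norms.Operator`, definitionally the product
topology), `γ ∈ GL_n(E)` REGULAR SEMISIMPLE in the sense `charpoly γ` separable, `ad γ = L_γ − R_γ`, slice
`𝔪 = range (ad γ)`, commutant `𝔠 = ker (ad γ) = C(γ)` (★ chart-A: `M = 𝔪 ⊕ 𝔠`), and the tree's Cayley transform
`c = Literature.Analysis.Calculus.cayley`, `c(X) = (1 − X)(1 + X)⁻¹` (`c(0) = 1`, `c(X)⁻¹ = c(−X)`).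

* §1 `hasStrictFDerivAt_cayley_zero` — in ANY complete normed algebra over a nontrivially normed field `𝕜`, `c` has
  strict derivative `−2·id` at `0` (product rule + Mathlib `hasStrictFDerivAt_ringInverse`; the archimedean, non-strict
  `ℝ`-version is ★ `Literature.Analysis.Calculus.hasFDerivAt_cayley_zero`).
* §2 **`exists_openPartialHomeomorph_cayleyConj`** — THE REGULAR ORBIT CHART IN CAYLEY COORDINATES: an
  `OpenPartialHomeomorph e : 𝔪 × 𝔠 → M` with `0 ∈ e.source`, `γ ∈ e.target`,
  `e (X, Y) = c(X) · γ c(Y) · c(X)⁻¹` EVERYWHERE, and `1 ± X`, `1 ± Y` units on `e.source` (its strict derivative at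
  `0` is `(X, Y) ↦ 2(γX − Xγ) − 2γY = 2·(ad γ (X) − γY)`, an isomorphism `𝔪 × 𝔠 ≃ M` by ★ chart-A exactly as in
  ★ chart-2 `exists_openPartialHomeomorph_conjOrbit`; Mathlib's inverse function theorem over `𝕜 = E`).  The torus
  parameter is MULTIPLICATIVE (`γ · c(Y)`, `c(Y) ∈ C(γ)`), which is what makes the unitary restriction linear:
* §3 **`exists_openPartialHomeomorph_cayleyConj_isImage_unitary`** — for `σ : E →+* E` continuous, `J` with unit
  determinant and `γ ∈ U(σ, J) = unitaryGroupOfForm σ J`, the chart may be shrunk (still `0 ∈ source`,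
  `γ ∈ target`, same formula) so that `e.IsImage {(X, Y) ∣ θ_J X = −X ∧ θ_J Y = −Y} {W ∣ W ∈ U(σ, J)}` with
  `θ_J X = J⁻¹ (X.map σ)ᵀ J` spelled inline: IN THESE COORDINATES `U(σ, J)` IS THE LINEAR SUBSPACE `(𝔲 ∩ 𝔪) × (𝔲 ∩ 𝔠)`.
  Proof: (⇐) ★ FILE 1 `antiHom_cayleyConj_mul_self` (`c(𝔲) ⊆ U`); (⇒) if `W = e(X, Y) ∈ U` then ★ FILE 1
  `cayleyConj_antiHom_eq_of_mul_self` says `W = e(−θX, −θY)` too, and `(X, Y) ↦ (−θ_J X, −θ_J Y)` preserves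
  `𝔪 × 𝔠` (★ `formAdjoint_mem_range_ad` ∕ `_ker_ad`) and the (θ-symmetrised) source, so `e.injOn` forces
  `θX = −X`, `θY = −Y`.  No exponential, no Lie theory, no measure.

HONEST SCOPE.  Point-set ∕ differential topology of matrices only.  HC_CM is proved only modulo the printed citations
until rung 0 closes; this file discharges no printed statement (currency for the road's N6 non-split (ii)–(iv)).

## References

* [HarishChandra1970] Harish-Chandra (notes by G. van Dijk), *Harmonic Analysis on Reductive p-adic Groups*, LNM 162
  (1970), Part I §3 (the submersion `G × T′ → G`, local product structure of regular orbits).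
* [Borel1991] A. Borel, *Linear Algebraic Groups*, 2nd ed. (1991), I.4 (4.2, 4.4) and V.23.4 (unitary groups).
* [Weyl1939] H. Weyl, *The Classical Groups* (1939), Ch. II §10 (Cayley parametrisation).
* [Rogawski1990] J. Rogawski, *Automorphic Representations of Unitary Groups in Three Variables* (1990), §4.3 p. 43,
  §4.9 (where smooth transfer at non-split places uses the local structure of regular orbits).
-/

set_option autoImplicit false

noncomputable section

open Filter Topology Set
open scoped Matrix.Norms.Operator Matrix

namespace Literature.NumberTheory.Automorphic

open Literature.Analysis.Calculus Literature.LinearAlgebra.Matrix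

/-! ### 1. The strict derivative of the Cayley transform at `0` -/

section Cayley

variable {𝕜 : Type*} [NontriviallyNormedField 𝕜] {R : Type*} [NormedRing R] [NormedAlgebra 𝕜 R] [CompleteSpace R]

/-- **`Dc(0) = −2·id`**, STRICTLY: the Cayley transform `c(X) = (1 − X)(1 + X)⁻¹` of a complete normed
`𝕜`-algebra has strict Fréchet derivative `−2·id` at `0`. [cite: Weyl1939, Ch. II §10] -/
theorem hasStrictFDerivAt_cayley_zero :
    HasStrictFDerivAt (cayley : R → R) (-((2 : 𝕜) • ContinuousLinearMap.id 𝕜 R)) 0 := by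
  have h1 : HasStrictFDerivAt (fun X : R => (1 : R) - X) (-(ContinuousLinearMap.id 𝕜 R)) 0 :=
    (hasStrictFDerivAt_id (𝕜 := 𝕜) (0 : R)).const_sub 1
  have h2 : HasStrictFDerivAt (fun X : R => (1 : R) + X) (ContinuousLinearMap.id 𝕜 R) 0 :=
    (hasStrictFDerivAt_id (𝕜 := 𝕜) (0 : R)).const_add 1
  have hpt : (fun X : R => (1 : R) + X) 0 = ((1 : Rˣ) : R) := by simp
  have hg : HasStrictFDerivAt (Ring.inverse : R → R)
      (-ContinuousLinearMap.mulLeftRight 𝕜 R (((1 : Rˣ)⁻¹ : Rˣ) : R) (((1 : Rˣ)⁻¹ : Rˣ) : R))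
      ((fun X : R => (1 : R) + X) 0) := by
    rw [hpt]; exact hasStrictFDerivAt_ringInverse (1 : Rˣ)
  have h3 := HasStrictFDerivAt.comp (f := fun X : R => (1 : R) + X) 0 hg h2
  have h := h1.mul' h3
  refine h.congr_fderiv (ContinuousLinearMap.ext fun H => ?_)
  simp only [_root_.add_apply, _root_.smul_apply, ContinuousLinearMap.comp_apply, _root_.neg_apply,
    ContinuousLinearMap.id_apply, ContinuousLinearMap.mulLeftRight_apply, sub_zero, add_zero, Ring.inverse_one, inv_one, Units.val_one, one_mul, mul_one,
    smul_eq_mul, MulOpposite.smul_eq_mul_unop, MulOpposite.unop_op, two_smul, neg_add, smul_neg]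

end Cayley

/-! ### 2. The regular orbit chart in Cayley coordinates -/

section Chart

variable {E : Type*} [NontriviallyNormedField E] [CompleteSpace E] [CharZero E] {n : Type*} [Fintype n]
  [DecidableEq n]

omit [CharZero E] in
/-- The strict derivative of `(X, Y) ↦ c(X) · γ c(Y) · c(X)⁻¹` on `C₁ × C₂` (two subspaces of `M_n(E)`) at `(0, 0)`:
a continuous linear `D` with `D (X, Y) = 2·(γX − Xγ − γY)`. [folklore] -/
private theorem hasStrictFDerivAt_cayleyConj_slice (γ : Matrix n n E) (C₁ C₂ : Submodule E (Matrix n n E)) :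
    ∃ D : (C₁ × C₂) →L[E] Matrix n n E,
      (∀ X : C₁, ∀ Y : C₂, D (X, Y) =
        (2 : E) • (γ * (X : Matrix n n E) - (X : Matrix n n E) * γ - γ * (Y : Matrix n n E))) ∧
      HasStrictFDerivAt (fun p : C₁ × C₂ =>
        cayley (p.1 : Matrix n n E) * (γ * cayley (p.2 : Matrix n n E)) *
          Ring.inverse (cayley (p.1 : Matrix n n E))) D 0 := by
  -- completeness pinned to the NORMED uniformity (the tree also carries the product uniformity `Matrix.instUniformSpace`)
  haveI : @CompleteSpace (Matrix n n E) PseudoMetricSpace.toUniformSpace :=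
    FiniteDimensional.complete E (Matrix n n E)
  have hπ₁ : HasStrictFDerivAt (fun p : C₁ × C₂ => (p.1 : Matrix n n E))
      ((C₁.subtypeL).comp (ContinuousLinearMap.fst E C₁ C₂)) 0 :=
    ((C₁.subtypeL).comp (ContinuousLinearMap.fst E C₁ C₂)).hasStrictFDerivAt
  have hπ₂ : HasStrictFDerivAt (fun p : C₁ × C₂ => (p.2 : Matrix n n E))
      ((C₂.subtypeL).comp (ContinuousLinearMap.snd E C₁ C₂)) 0 :=
    ((C₂.subtypeL).comp (ContinuousLinearMap.snd E C₁ C₂)).hasStrictFDerivAt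
  have hpt₁ : (fun p : C₁ × C₂ => (p.1 : Matrix n n E)) 0 = 0 := by simp
  have hpt₂ : (fun p : C₁ × C₂ => (p.2 : Matrix n n E)) 0 = 0 := by simp
  have hc₁ : HasStrictFDerivAt (cayley : Matrix n n E → Matrix n n E)
      (-((2 : E) • ContinuousLinearMap.id E (Matrix n n E))) ((fun p : C₁ × C₂ => (p.1 : Matrix n n E)) 0) := by
    rw [hpt₁]; exact hasStrictFDerivAt_cayley_zero
  have hc₂ : HasStrictFDerivAt (cayley : Matrix n n E → Matrix n n E)
      (-((2 : E) • ContinuousLinearMap.id E (Matrix n n E))) ((fun p : C₁ × C₂ => (p.2 : Matrix n n E)) 0) := by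
    rw [hpt₂]; exact hasStrictFDerivAt_cayley_zero
  have ha := HasStrictFDerivAt.comp (f := fun p : C₁ × C₂ => (p.1 : Matrix n n E)) 0 hc₁ hπ₁
  have hb := (HasStrictFDerivAt.comp (f := fun p : C₁ × C₂ => (p.2 : Matrix n n E)) 0 hc₂ hπ₂).const_mul γ
  have hptc : (cayley ∘ fun p : C₁ × C₂ => (p.1 : Matrix n n E)) 0 = ((1 : (Matrix n n E)ˣ) : Matrix n n E) := by
    simp
  have hg : HasStrictFDerivAt (Ring.inverse : Matrix n n E → Matrix n n E)
      (-ContinuousLinearMap.mulLeftRight E (Matrix n n E) (((1 : (Matrix n n E)ˣ)⁻¹ : (Matrix n n E)ˣ) : Matrix n n E)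
        (((1 : (Matrix n n E)ˣ)⁻¹ : (Matrix n n E)ˣ) : Matrix n n E))
      ((cayley ∘ fun p : C₁ × C₂ => (p.1 : Matrix n n E)) 0) := by
    rw [hptc]; exact hasStrictFDerivAt_ringInverse (1 : (Matrix n n E)ˣ)
  have hcinv := HasStrictFDerivAt.comp (f := cayley ∘ fun p : C₁ × C₂ => (p.1 : Matrix n n E)) 0 hg ha
  have hΦ := (ha.mul' hb).mul' hcinv
  refine ⟨_, fun X Y => ?_, hΦ⟩
  refine (?_ : _ = cayley (((0 : C₁ × C₂).1 : Matrix n n E)) * (γ * cayley (((0 : C₁ × C₂).2 : Matrix n n E))) *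
      (-((((1 : (Matrix n n E)ˣ)⁻¹ : (Matrix n n E)ˣ) : Matrix n n E) * (-((2 : E) • (X : Matrix n n E))) *
        (((1 : (Matrix n n E)ˣ)⁻¹ : (Matrix n n E)ˣ) : Matrix n n E))) +
      (cayley (((0 : C₁ × C₂).1 : Matrix n n E)) * (γ * (-((2 : E) • (Y : Matrix n n E)))) +
          (-((2 : E) • (X : Matrix n n E))) * (γ * cayley (((0 : C₁ × C₂).2 : Matrix n n E)))) *
        Ring.inverse (cayley (((0 : C₁ × C₂).1 : Matrix n n E)))).trans ?_
  · rfl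
  · simp only [Prod.fst_zero, Prod.snd_zero, ZeroMemClass.coe_zero, cayley_zero, inv_one, Units.val_one,
      Ring.inverse_one, one_mul, mul_one, mul_neg, neg_mul, neg_neg, two_smul, mul_add, add_mul, smul_sub]
    abel

/-- **The regular orbit chart in Cayley coordinates.**  For `γ ∈ GL_n(E)` with separable characteristic polynomial
(`E` complete nontrivially normed of characteristic `0`), `ad γ = L_γ − R_γ`, `𝔪 = range (ad γ)`, `𝔠 = ker (ad γ)`:
an `OpenPartialHomeomorph e : 𝔪 × 𝔠 → M_n(E)` with `0 ∈ e.source`, `γ ∈ e.target`, which IS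
`e (X, Y) = c(X) · γ c(Y) · c(X)⁻¹` (`c` the Cayley transform) and on whose source `1 ± X`, `1 ± Y` are units.
(Strict derivative `2·(ad γ (X) − γY)`, an isomorphism by ★ chart-A `M = 𝔪 ⊕ 𝔠`; inverse function theorem.)
[cite: HarishChandra1970, Part I §3] [cite: Borel1991, I.4 (4.2, 4.4)] [cite: Weyl1939, Ch. II §10] -/
theorem exists_openPartialHomeomorph_cayleyConj (γ : GL n E) (hγ : (γ : Matrix n n E).charpoly.Separable) :
    ∃ e : OpenPartialHomeomorph
        (↥(LinearMap.range (LinearMap.mulLeft E (γ : Matrix n n E) - LinearMap.mulRight E (γ : Matrix n n E) :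
            Module.End E (Matrix n n E))) ×
          ↥(LinearMap.ker (LinearMap.mulLeft E (γ : Matrix n n E) - LinearMap.mulRight E (γ : Matrix n n E) :
            Module.End E (Matrix n n E))))
        (Matrix n n E),
      0 ∈ e.source ∧ (γ : Matrix n n E) ∈ e.target ∧
      (∀ p, e p = cayley (p.1 : Matrix n n E) * ((γ : Matrix n n E) * cayley (p.2 : Matrix n n E)) *
        Ring.inverse (cayley (p.1 : Matrix n n E))) ∧
      ∀ p ∈ e.source, IsUnit (1 + (p.1 : Matrix n n E)) ∧ IsUnit (1 - (p.1 : Matrix n n E)) ∧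
        IsUnit (1 + (p.2 : Matrix n n E)) ∧ IsUnit (1 - (p.2 : Matrix n n E)) := by
  haveI : @CompleteSpace (Matrix n n E) PseudoMetricSpace.toUniformSpace :=
    FiniteDimensional.complete E (Matrix n n E)
  set A : Matrix n n E := (γ : Matrix n n E) with hAdef
  set ad : Module.End E (Matrix n n E) := LinearMap.mulLeft E A - LinearMap.mulRight E A with had
  haveI : @CompleteSpace ↥(LinearMap.range ad) PseudoMetricSpace.toUniformSpace := FiniteDimensional.complete E _
  haveI : @CompleteSpace ↥(LinearMap.ker ad) PseudoMetricSpace.toUniformSpace := FiniteDimensional.complete E _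
  have hc := Literature.LinearAlgebra.Matrix.isCompl_ker_range_mulLeft_sub_mulRight_of_separable_charpoly A hγ
  rw [← had] at hc
  have had_apply : ∀ X : Matrix n n E, ad X = A * X - X * A := fun X => by
    rw [had, LinearMap.sub_apply, LinearMap.mulLeft_apply, LinearMap.mulRight_apply]
  obtain ⟨D, hD, hΦ⟩ := hasStrictFDerivAt_cayleyConj_slice A (LinearMap.range ad) (LinearMap.ker ad)
  have two_ne : (2 : E) ≠ 0 := two_ne_zero
  -- `D (X, Y) = 2·(ad X − A Y)` is injective …
  have hinj : LinearMap.ker (D : (↥(LinearMap.range ad) × ↥(LinearMap.ker ad)) →ₗ[E] Matrix n n E) = ⊥ := by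
    refine LinearMap.ker_eq_bot'.mpr fun p hp => ?_
    obtain ⟨X, Y⟩ := p
    rw [ContinuousLinearMap.coe_coe, hD] at hp
    have hW : A * (X : Matrix n n E) - (X : Matrix n n E) * A - A * (Y : Matrix n n E) = 0 := by
      have h2 := congrArg (fun W => (2⁻¹ : E) • W) hp
      simpa only [smul_smul, inv_mul_cancel₀ two_ne, one_smul, smul_zero] using h2
    -- `ad X = A Y ∈ range ad ⊓ ker ad = ⊥`
    have hYeq : A * (Y : Matrix n n E) = ad (X : Matrix n n E) := by rw [had_apply]; exact (sub_eq_zero.1 hW).symm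
    have hAY : A * (Y : Matrix n n E) ∈ LinearMap.ker ad := by
      rw [LinearMap.mem_ker, had_apply]
      have hY := Y.2; rw [LinearMap.mem_ker, had_apply, sub_eq_zero] at hY
      rw [Matrix.mul_assoc, ← hY, ← Matrix.mul_assoc, sub_self]
    have hY0 : A * (Y : Matrix n n E) = 0 := by
      have hmem : A * (Y : Matrix n n E) ∈ LinearMap.ker ad ⊓ LinearMap.range ad :=
        Submodule.mem_inf.mpr ⟨hAY, hYeq ▸ LinearMap.mem_range_self ad _⟩
      rwa [hc.inf_eq_bot, Submodule.mem_bot] at hmem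
    have hY0' : (Y : Matrix n n E) = 0 := by
      have := congrArg (fun W => ((γ⁻¹ : GL n E) : Matrix n n E) * W) hY0
      simpa only [← Matrix.mul_assoc, hAdef, ← Units.val_mul, inv_mul_cancel, Units.val_one, Matrix.one_mul,
        Matrix.mul_zero] using this
    have hX0 : (X : Matrix n n E) = 0 := by
      have hXker : (X : Matrix n n E) ∈ LinearMap.ker ad := by rw [LinearMap.mem_ker, ← hYeq, hY0]
      have hmem : (X : Matrix n n E) ∈ LinearMap.ker ad ⊓ LinearMap.range ad := Submodule.mem_inf.mpr ⟨hXker, X.2⟩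
      rwa [hc.inf_eq_bot, Submodule.mem_bot] at hmem
    exact Prod.ext (Subtype.ext hX0) (Subtype.ext hY0')
  -- … and surjective (`M = [A, M] + C(A)`, `ad` maps `range ad` onto itself, `A⁻¹ C(A) ⊆ C(A)`)
  have hsurj : LinearMap.range (D : (↥(LinearMap.range ad) × ↥(LinearMap.ker ad)) →ₗ[E] Matrix n n E) = ⊤ := by
    refine LinearMap.range_eq_top.mpr fun Z => ?_
    obtain ⟨X₀, Y₀, hcomm, hZ⟩ :=
      Literature.LinearAlgebra.Matrix.exists_commute_add_commutator_eq_of_separable_charpoly A hγ ((2⁻¹ : E) • Z)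
    have hX₀ : X₀ ∈ LinearMap.ker ad ⊔ LinearMap.range ad := by rw [hc.sup_eq_top]; exact Submodule.mem_top
    obtain ⟨K₀, hK₀, R₀, hR₀, hsum⟩ := Submodule.mem_sup.mp hX₀
    have hK : A * K₀ = K₀ * A := by
      have h := hK₀; rw [LinearMap.mem_ker, had_apply, sub_eq_zero] at h; exact h
    have hY : -(((γ⁻¹ : GL n E) : Matrix n n E) * Y₀) ∈ LinearMap.ker ad := by
      refine (LinearMap.ker ad).neg_mem ?_
      rw [LinearMap.mem_ker, had_apply, sub_eq_zero, hAdef, ← Matrix.mul_assoc, ← Units.val_mul, mul_inv_cancel,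
        Units.val_one, Matrix.one_mul, Matrix.mul_assoc, hcomm, ← Matrix.mul_assoc, ← Units.val_mul,
        inv_mul_cancel, Units.val_one, Matrix.one_mul]
    refine ⟨(⟨R₀, hR₀⟩, ⟨_, hY⟩), ?_⟩
    rw [ContinuousLinearMap.coe_coe, hD]
    have hW : A * R₀ - R₀ * A - A * -(((γ⁻¹ : GL n E) : Matrix n n E) * Y₀) = (2⁻¹ : E) • Z := by
      rw [hZ, ← hsum, Matrix.mul_neg, sub_neg_eq_add, hAdef, ← Matrix.mul_assoc, ← Units.val_mul, mul_inv_cancel,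
        Units.val_one, Matrix.one_mul, Matrix.mul_add, Matrix.add_mul, hK, add_sub_add_left_eq_sub]
    rw [Subtype.coe_mk, Subtype.coe_mk, hW, smul_smul, mul_inv_cancel₀ two_ne, one_smul]
  -- the derivative as a continuous linear EQUIVALENCE, and the inverse function theorem
  have hΦ' := hΦ.congr_fderiv (ContinuousLinearEquiv.coe_ofBijective D hinj hsurj).symm
  -- shrink to the locus where `1 ± X`, `1 ± Y` are units
  set V : Set (↥(LinearMap.range ad) × ↥(LinearMap.ker ad)) :=
    {p | IsUnit (1 + (p.1 : Matrix n n E)) ∧ IsUnit (1 - (p.1 : Matrix n n E)) ∧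
      IsUnit (1 + (p.2 : Matrix n n E)) ∧ IsUnit (1 - (p.2 : Matrix n n E))} with hV
  have hc1 : Continuous fun p : ↥(LinearMap.range ad) × ↥(LinearMap.ker ad) => (p.1 : Matrix n n E) :=
    continuous_subtype_val.comp continuous_fst
  have hc2 : Continuous fun p : ↥(LinearMap.range ad) × ↥(LinearMap.ker ad) => (p.2 : Matrix n n E) :=
    continuous_subtype_val.comp continuous_snd
  have hVo : IsOpen V :=
    (Units.isOpen.preimage (continuous_const.add hc1)).inter ((Units.isOpen.preimage (continuous_const.sub hc1)).inter
      ((Units.isOpen.preimage (continuous_const.add hc2)).inter (Units.isOpen.preimage (continuous_const.sub hc2))))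
  have h0V : (0 : ↥(LinearMap.range ad) × ↥(LinearMap.ker ad)) ∈ V := by
    simp only [hV, Set.mem_setOf_eq, Prod.fst_zero, Prod.snd_zero, ZeroMemClass.coe_zero, add_zero, sub_zero]
    exact ⟨isUnit_one, isUnit_one, isUnit_one, isUnit_one⟩
  have h0 : cayley (((0 : ↥(LinearMap.range ad) × ↥(LinearMap.ker ad)).1 : Matrix n n E)) *
      (A * cayley (((0 : ↥(LinearMap.range ad) × ↥(LinearMap.ker ad)).2 : Matrix n n E))) *
      Ring.inverse (cayley (((0 : ↥(LinearMap.range ad) × ↥(LinearMap.ker ad)).1 : Matrix n n E))) = A := by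
    simp only [Prod.fst_zero, Prod.snd_zero, ZeroMemClass.coe_zero, cayley_zero, Ring.inverse_one, mul_one, one_mul]
  refine ⟨(hΦ'.toOpenPartialHomeomorph _).restrOpen V hVo, ?_, ?_, fun p => rfl, fun p hp => ?_⟩
  · rw [OpenPartialHomeomorph.restrOpen_source]
    exact ⟨hΦ'.mem_toOpenPartialHomeomorph_source, h0V⟩
  · have himg := ((hΦ'.toOpenPartialHomeomorph _).restrOpen V hVo).map_source
      (x := (0 : ↥(LinearMap.range ad) × ↥(LinearMap.ker ad)))
      (by rw [OpenPartialHomeomorph.restrOpen_source]; exact ⟨hΦ'.mem_toOpenPartialHomeomorph_source, h0V⟩)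
    rw [OpenPartialHomeomorph.coe_restrOpen, HasStrictFDerivAt.toOpenPartialHomeomorph_coe, h0] at himg
    exact himg
  · rw [OpenPartialHomeomorph.restrOpen_source] at hp
    exact hp.2

/-! ### 3. Restriction to a unitary group: in Cayley coordinates `U(σ, J)` is a linear subspace -/

/-- **The regular orbit chart restricted to a unitary group.**  Let `σ : E →+* E` be continuous, `J ∈ M_n(E)` with
unit determinant, `γ ∈ U(σ, J) = unitaryGroupOfForm σ J` with separable characteristic polynomial, and write
`θ X = J⁻¹ (X.map σ)ᵀ J` (the form adjoint: `U(σ, J) = {g ∣ θ g · g = 1}`, Lie algebra `𝔲 = {X ∣ θ X = −X}`).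
Then the Cayley-coordinate chart `e (X, Y) = c(X) · γ c(Y) · c(X)⁻¹` of `exists_openPartialHomeomorph_cayleyConj`
may be shrunk (still `0 ∈ e.source`, `γ ∈ e.target`, same formula, `1 ± X`, `1 ± Y` units on the source) so that
**`e.IsImage {(X, Y) ∣ θ X = −X ∧ θ Y = −Y} {W ∣ ∃ g ∈ U(σ, J), ↑g = W}`**: near `γ`, the elements of `U(σ, J)` are
EXACTLY the `c(X) · γ c(Y) · c(X)⁻¹` with `X ∈ 𝔲 ∩ 𝔪`, `Y ∈ 𝔲 ∩ 𝔠` — a neighbourhood of `γ` in `U(σ, J)` is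
parametrised by (slice in `𝔲`) × (torus `γ · c(𝔲 ∩ C(γ)) ⊆ U ∩ C(γ)`).  ((⇐) ★ `antiHom_cayleyConj_mul_self`;
(⇒) ★ `cayleyConj_antiHom_eq_of_mul_self` + `e.injOn` on the `θ`-symmetrised source, `θ` preserving `𝔪 × 𝔠` by
★ `formAdjoint_mem_range_ad` ∕ `formAdjoint_mem_ker_ad`.)
[cite: HarishChandra1970, Part I §3] [cite: Borel1991, V.23.4] [cite: Weyl1939, Ch. II §10]
[cite: Rogawski1990, §4.9 p. 55] -/
theorem exists_openPartialHomeomorph_cayleyConj_isImage_unitary (σ : E →+* E) (hσ : Continuous σ)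
    {J : Matrix n n E} (hJ : IsUnit J.det) (γ : GL n E) (hγU : γ ∈ unitaryGroupOfForm σ J)
    (hγ : (γ : Matrix n n E).charpoly.Separable) :
    ∃ e : OpenPartialHomeomorph
        (↥(LinearMap.range (LinearMap.mulLeft E (γ : Matrix n n E) - LinearMap.mulRight E (γ : Matrix n n E) :
            Module.End E (Matrix n n E))) ×
          ↥(LinearMap.ker (LinearMap.mulLeft E (γ : Matrix n n E) - LinearMap.mulRight E (γ : Matrix n n E) :
            Module.End E (Matrix n n E))))
        (Matrix n n E),
      0 ∈ e.source ∧ (γ : Matrix n n E) ∈ e.target ∧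
      (∀ p, e p = cayley (p.1 : Matrix n n E) * ((γ : Matrix n n E) * cayley (p.2 : Matrix n n E)) *
        Ring.inverse (cayley (p.1 : Matrix n n E))) ∧
      (∀ p ∈ e.source, IsUnit (1 + (p.1 : Matrix n n E)) ∧ IsUnit (1 - (p.1 : Matrix n n E)) ∧
        IsUnit (1 + (p.2 : Matrix n n E)) ∧ IsUnit (1 - (p.2 : Matrix n n E))) ∧
      e.IsImage
        {p | J⁻¹ * ((p.1 : Matrix n n E).map σ)ᵀ * J = -(p.1 : Matrix n n E) ∧
          J⁻¹ * ((p.2 : Matrix n n E).map σ)ᵀ * J = -(p.2 : Matrix n n E)}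
        {W | ∃ g ∈ unitaryGroupOfForm σ J, (g : Matrix n n E) = W} := by
  set ad : Module.End E (Matrix n n E) :=
    LinearMap.mulLeft E (γ : Matrix n n E) - LinearMap.mulRight E (γ : Matrix n n E) with had
  obtain ⟨e₀, h0, hγt, he₀, hunits⟩ := exists_openPartialHomeomorph_cayleyConj γ hγ
  -- the form adjoint `θ` and the reflection `Θ (X, Y) = (−θ X, −θ Y)` of `𝔪 × 𝔠`
  set θ : Matrix n n E → Matrix n n E := fun X => J⁻¹ * (X.map σ)ᵀ * J with hθ
  have hθc : Continuous θ :=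
    (continuous_const.mul ((continuous_id.matrix_map hσ).matrix_transpose)).mul continuous_const
  have hθm : ∀ X Y, θ (X * Y) = θ Y * θ X := formAdjoint_mul σ hJ
  have hθ1 : θ 1 = 1 := formAdjoint_one σ hJ
  have hθa : ∀ X Y, θ (X + Y) = θ X + θ Y := formAdjoint_add σ
  have hθs : ∀ X Y, θ (X - Y) = θ X - θ Y := formAdjoint_sub σ
  have hθγ : θ (γ : Matrix n n E) = ((γ⁻¹ : GL n E) : Matrix n n E) := formAdjoint_coe_eq_coe_inv σ hJ hγU
  have hγγ' : (γ : Matrix n n E) * ((γ⁻¹ : GL n E) : Matrix n n E) = 1 := by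
    rw [← Units.val_mul, mul_inv_cancel, Units.val_one]
  have hγ'γ : ((γ⁻¹ : GL n E) : Matrix n n E) * (γ : Matrix n n E) = 1 := by
    rw [← Units.val_mul, inv_mul_cancel, Units.val_one]
  let Θ : ↥(LinearMap.range ad) × ↥(LinearMap.ker ad) → ↥(LinearMap.range ad) × ↥(LinearMap.ker ad) := fun p =>
    (⟨-θ (p.1 : Matrix n n E), (LinearMap.range ad).neg_mem (formAdjoint_mem_range_ad σ hJ hγU p.1.2)⟩,
      ⟨-θ (p.2 : Matrix n n E), (LinearMap.ker ad).neg_mem (formAdjoint_mem_ker_ad σ hJ hγU p.2.2)⟩)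
  have hΘ₁ : ∀ p, ((Θ p).1 : Matrix n n E) = -θ (p.1 : Matrix n n E) := fun p => rfl
  have hΘ₂ : ∀ p, ((Θ p).2 : Matrix n n E) = -θ (p.2 : Matrix n n E) := fun p => rfl
  have hc1 : Continuous fun p : ↥(LinearMap.range ad) × ↥(LinearMap.ker ad) => (p.1 : Matrix n n E) :=
    continuous_subtype_val.comp continuous_fst
  have hc2 : Continuous fun p : ↥(LinearMap.range ad) × ↥(LinearMap.ker ad) => (p.2 : Matrix n n E) :=
    continuous_subtype_val.comp continuous_snd
  have hΘc : Continuous Θ :=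
    ((hθc.comp hc1).neg.subtype_mk _).prodMk ((hθc.comp hc2).neg.subtype_mk _)
  -- the θ-symmetric open piece of the source on which `1 ± θX`, `1 ± θY` are units too
  haveI : @CompleteSpace (Matrix n n E) PseudoMetricSpace.toUniformSpace :=
    FiniteDimensional.complete E (Matrix n n E)
  set V : Set (↥(LinearMap.range ad) × ↥(LinearMap.ker ad)) :=
    Θ ⁻¹' e₀.source ∩ {p | IsUnit (1 + θ (p.1 : Matrix n n E)) ∧ IsUnit (1 - θ (p.1 : Matrix n n E)) ∧
      IsUnit (1 + θ (p.2 : Matrix n n E)) ∧ IsUnit (1 - θ (p.2 : Matrix n n E))} with hV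
  have hVo : IsOpen V :=
    (e₀.open_source.preimage hΘc).inter
      ((Units.isOpen.preimage (continuous_const.add (hθc.comp hc1))).inter
        ((Units.isOpen.preimage (continuous_const.sub (hθc.comp hc1))).inter
          ((Units.isOpen.preimage (continuous_const.add (hθc.comp hc2))).inter
            (Units.isOpen.preimage (continuous_const.sub (hθc.comp hc2))))))
  have hθ0 : θ 0 = 0 := by
    rw [hθ]; simp only [Matrix.map_zero σ (map_zero σ), Matrix.transpose_zero, Matrix.mul_zero, Matrix.zero_mul]
  have hΘ0 : Θ 0 = 0 := by
    refine Prod.ext (Subtype.ext ?_) (Subtype.ext ?_)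
    · rw [hΘ₁]; simp [hθ0]
    · rw [hΘ₂]; simp [hθ0]
  have h0V : (0 : ↥(LinearMap.range ad) × ↥(LinearMap.ker ad)) ∈ V := by
    refine ⟨?_, ?_⟩
    · show Θ 0 ∈ e₀.source; rw [hΘ0]; exact h0
    · simp only [Set.mem_setOf_eq, Prod.fst_zero, Prod.snd_zero, ZeroMemClass.coe_zero, hθ0, add_zero, sub_zero]
      exact ⟨isUnit_one, isUnit_one, isUnit_one, isUnit_one⟩
  refine ⟨e₀.restrOpen V hVo, ?_, ?_, fun p => he₀ p, fun p hp => ?_, fun p hp => ?_⟩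
  · rw [OpenPartialHomeomorph.restrOpen_source]; exact ⟨h0, h0V⟩
  · have himg := (e₀.restrOpen V hVo).map_source (x := 0)
      (by rw [OpenPartialHomeomorph.restrOpen_source]; exact ⟨h0, h0V⟩)
    rw [OpenPartialHomeomorph.coe_restrOpen, he₀] at himg
    simpa only [Prod.fst_zero, Prod.snd_zero, ZeroMemClass.coe_zero, cayley_zero, Ring.inverse_one, mul_one,
      one_mul] using himg
  · rw [OpenPartialHomeomorph.restrOpen_source] at hp
    exact hunits p hp.1
  · -- `IsImage`: for `p` in the shrunk source, `e p ∈ U(σ, J) ↔ θX = −X ∧ θY = −Y`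
    rw [OpenPartialHomeomorph.restrOpen_source] at hp
    obtain ⟨hp0, hpΘ, hap, ham, hbp, hbm⟩ := hp
    obtain ⟨hxp, hxm, hyp, hym⟩ := hunits p hp0
    show e₀ p ∈ {W | ∃ g ∈ unitaryGroupOfForm σ J, (g : Matrix n n E) = W} ↔ _
    rw [he₀ p, Set.mem_setOf_eq, Set.mem_setOf_eq]
    constructor
    · rintro ⟨g, hgU, hgW⟩
      have h1 : θ (cayley (p.1 : Matrix n n E) * ((γ : Matrix n n E) * cayley (p.2 : Matrix n n E)) *
          Ring.inverse (cayley (p.1 : Matrix n n E))) *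
          (cayley (p.1 : Matrix n n E) * ((γ : Matrix n n E) * cayley (p.2 : Matrix n n E)) *
            Ring.inverse (cayley (p.1 : Matrix n n E))) = 1 := by
        rw [← hgW]; exact (mem_unitaryGroupOfForm_iff_formAdjoint_mul_eq_one σ hJ g).1 hgU
      have key := cayleyConj_antiHom_eq_of_mul_self θ hθm hθ1 hθa hθs hθγ hγγ' hxp hxm hyp hap ham hbp hbm h1
      have hΘp : e₀ (Θ p) = e₀ p := by rw [he₀, he₀, hΘ₁, hΘ₂]; exact key
      have hfix : Θ p = p := e₀.injOn hpΘ hp0 hΘp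
      have h₁ := congrArg (fun q : ↥(LinearMap.range ad) × ↥(LinearMap.ker ad) => (q.1 : Matrix n n E)) hfix
      have h₂ := congrArg (fun q : ↥(LinearMap.range ad) × ↥(LinearMap.ker ad) => (q.2 : Matrix n n E)) hfix
      simp only [hΘ₁, hΘ₂] at h₁ h₂
      exact ⟨neg_eq_iff_eq_neg.1 h₁, neg_eq_iff_eq_neg.1 h₂⟩
    · rintro ⟨hX, hY⟩
      exact exists_mem_unitaryGroupOfForm_coe_eq σ hJ
        (antiHom_cayleyConj_mul_self θ hθm hθ1 hθa hθs hθγ hγ'γ hX hY hxp hxm hyp hym)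

end Chart

end Literature.NumberTheory.Automorphic

end
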